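import Summits.NavierStokesRegularity.NavierStokesRegularity.Theorems.ExtremiserTransienceNearExtremalTransienceCanonical
import Summits.NavierStokesRegularity.NavierStokesRegularity.Theorems.TypeICertificateLadderTargetStrainCubeLambSplitDepletion
import HarnessLib

/-!
# Route `ExtremiserTransience`, crux `NearExtremalTransience` (stmt-NavierStokesRegularity-21883):
# THE SHARP DEPLETION CONSTANT `κ⋆ = sInf V` IS UNIVERSAL; onset removal for log-time means

`--supports stmt-NavierStokesRegularity-21883` (route-independent half: no `Theses` import). Author: prover seat
`ns-et-p1` (g2), continuing the g0 files `…ThetaOne`, `…Canonical`.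

Write `V` for the set of universal depletion constants `κ` (the `κ`-premise of the crux: the depletion inequality
`|∫⟪ω, Dv ω⟫| ≤ κ·M·‖ω‖₂·‖∇ω‖₂` on the admissible class of `StrainCube.universal_depletion_constant_gt` — `C^∞`,
divergence free, `|v| ≤ M`, bounded gradient, `D⁰v, D¹v, D²v ∈ L²`) and `κ⋆ := sInf V` (spelled out as
`sInf {κ | …}`; no new definition is introduced).

* `DepletionLadder.sharpDepletion_le` — `κ⋆ ≤ κ` for every universal `κ` (`V` is bounded below by `0`).
* `DepletionLadder.sharpDepletion_is_universal` — **`κ⋆ ∈ V`**: for a fixed admissible field the admissible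
  constants form an up-closed ray, so `|∫⟪ω, Dv ω⟫|/(M‖ω‖₂‖∇ω‖₂)` is a lower bound of `V` (`le_csInf`; `V ≠ ∅` by
  `StrainCube.lambSplit_constant_is_universal`; the degenerate case `M‖ω‖₂‖∇ω‖₂ = 0` separately). Hence
  `V = [κ⋆, ∞)` and every statement «for all universal `κ`» with a conclusion monotone in `κ` is its instance at `κ⋆`.
* `DepletionLadder.sharpDepletion_gt`, `…_le_lambSplit`, `…_lt_one` — the landed bracket for `κ⋆`:
  `13/200 < κ⋆ ≤ (9+2√15)/42 < 1` (`StrainCube.universal_depletion_constant_gt_S5`, `…lambSplit_constant_is_universal`).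
* `DepletionLadder.logMean_bound_from_zero` — onset removal (calculus): for measurable `k : ℝ → [0,1]`,
  `0 ≤ t₁ < T`, `a ≥ 0`, a bound `∫_{t₁}^t k²/(T−τ) ≤ a·log((T−t₁)/(T−t)) + B` on `[t₁,T)` gives
  `∫_0^t k²/(T−τ) ≤ a·log(T/(T−t)) + B'` on `[0,T)` with `B' = ∫_0^{t₁} k²/(T−τ) + max B 0`.

Used by `…NearExtremalTransienceSharpForm.lean` (the crux ↔ its sharp, onset-free canonical form).
WHAT THIS IS NOT: the value of `κ⋆` is not computed; nothing dynamic is proved; the crux, the route and the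
summit stay open; Navier–Stokes regularity is NOT proved by anything here. [folklore]
-/

noncomputable section

open Set Filter Topology MeasureTheory
open scoped InnerProductSpace RealInnerProductSpace ENNReal NNReal ContDiff
open Literature.Analysis.FluidPDE

namespace Summit.NavierStokesRegularity.NavierStokesRegularity.Theorems

-- the problem directory repeats the summit name (`NavierStokesRegularity/NavierStokesRegularity`)
set_option linter.dupNamespace false

namespace DepletionLadder

/-- Every universal depletion constant is nonnegative (indeed `> 11/400`,
`StrainCube.universal_depletion_constant_gt`). [folklore] -/
theorem universal_depletion_constant_nonneg {κ : ℝ} (hκ : (∀ (v : EuclideanSpace ℝ (Fin 3) → EuclideanSpace ℝ (Fin 3)) (M B : ℝ), ContDiff ℝ (⊤ : ℕ∞) v → Literature.Analysis.FluidPDE.VectorCalculus.IsDivFree v → (∀ x, ‖v x‖ ≤ M) → (∀ x, ‖fderiv ℝ v x‖ ≤ B) → (∫⁻ x, ‖iteratedFDeriv ℝ 0 v x‖ₑ ^ 2 < ⊤) → (∫⁻ x, ‖iteratedFDeriv ℝ 1 v x‖ₑ ^ 2 < ⊤) → (∫⁻ x, ‖iteratedFDeriv ℝ 2 v x‖ₑ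 ^ 2 < ⊤) → |∫ x, ⟪Literature.Analysis.FluidPDE.curl v x, fderiv ℝ v x (Literature.Analysis.FluidPDE.curl v x)⟫_ℝ| ≤ κ * M * Real.sqrt (∫ x, ‖Literature.Analysis.FluidPDE.curl v x‖ ^ 2) * Real.sqrt (∫ x, Literature.Analysis.FluidPDE.frobeniusNormSq (fderiv ℝ (Literature.Analysis.FluidPDE.curl v) x)))) : 0 ≤ κ :=
  le_of_lt (lt_trans (by norm_num) (StrainCube.universal_depletion_constant_gt hκ))

/-- **`κ⋆ ≤ κ` for every universal depletion constant `κ`** (`κ⋆ = sInf` of the universal constants, a set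
bounded below by `0`). [folklore] -/
theorem sharpDepletion_le {κ : ℝ} (hκ : (∀ (v : EuclideanSpace ℝ (Fin 3) → EuclideanSpace ℝ (Fin 3)) (M B : ℝ), ContDiff ℝ (⊤ : ℕ∞) v → Literature.Analysis.FluidPDE.VectorCalculus.IsDivFree v → (∀ x, ‖v x‖ ≤ M) → (∀ x, ‖fderiv ℝ v x‖ ≤ B) → (∫⁻ x, ‖iteratedFDeriv ℝ 0 v x‖ₑ ^ 2 < ⊤) → (∫⁻ x, ‖iteratedFDeriv ℝ 1 v x‖ₑ ^ 2 < ⊤) → (∫⁻ x, ‖iteratedFDeriv ℝ 2 v x‖ₑ ^ 2 < ⊤) → |∫ x, ⟪Literature.Analysis.FluidPDE.curl v x, fderiv ℝ v x (Literature.Analysis.FluidPDE.curl v x)⟫_ℝ| ≤ κ * M * Real.sqrt (∫ x, ‖Literature.Analysis.FluidPDE.curl v x‖ ^ 2) * Real.sqrt (∫ x, Literature.Analysis.FluidPDE.frobeniusNormSq (fderiv ℝ (Literature.Analysis.FluidPDE.curl v) x)))) : sInf {κ : ℝ | (∀ (v : EuclideanSpace ℝ (Fin 3) → EuclideanSpace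 ℝ (Fin 3)) (M B : ℝ), ContDiff ℝ (⊤ : ℕ∞) v → Literature.Analysis.FluidPDE.VectorCalculus.IsDivFree v → (∀ x, ‖v x‖ ≤ M) → (∀ x, ‖fderiv ℝ v x‖ ≤ B) → (∫⁻ x, ‖iteratedFDeriv ℝ 0 v x‖ₑ ^ 2 < ⊤) → (∫⁻ x, ‖iteratedFDeriv ℝ 1 v x‖ₑ ^ 2 < ⊤) → (∫⁻ x, ‖iteratedFDeriv ℝ 2 v x‖ₑ ^ 2 < ⊤) → |∫ x, ⟪Literature.Analysis.FluidPDE.curl v x, fderiv ℝ v x (Literature.Analysis.FluidPDE.curl v x)⟫_ℝ| ≤ κ * M * Real.sqrt (∫ x, ‖Literature.Analysis.FluidPDE.curl v x‖ ^ 2) * Real.sqrt (∫ x, Literature.Analysis.FluidPDE.frobeniusNormSq (fderiv ℝ (Literature.Analysis.FluidPDE.curl v) x)))} ≤ κ :=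
  csInf_le ⟨0, fun _ hκ' => universal_depletion_constant_nonneg hκ'⟩ hκ

/-- **The sharp depletion constant is universal: `κ⋆ ∈ V`.** For a fixed admissible field `v` with bound `M`,
`D := M·‖ω‖₂·‖∇ω‖₂ ≥ 0`; if `D = 0` every universal constant gives `|∫⟪ω, Dv ω⟫| ≤ 0`, and if `D > 0` then
`|∫⟪ω, Dv ω⟫|/D` is a lower bound of `V`, hence `≤ sInf V` (`V ≠ ∅`: `(9+2√15)/42 ∈ V`,
`StrainCube.lambSplit_constant_is_universal`). [folklore] -/
theorem sharpDepletion_is_universal : (∀ (v : EuclideanSpace ℝ (Fin 3) → EuclideanSpace ℝ (Fin 3)) (M B : ℝ), ContDiff ℝ (⊤ : ℕ∞) v → Literature.Analysis.FluidPDE.VectorCalculus.IsDivFree v → (∀ x, ‖v x‖ ≤ M) → (∀ x, ‖fderiv ℝ v x‖ ≤ B) → (∫⁻ x, ‖iteratedFDeriv ℝ 0 v x‖ₑ ^ 2 < ⊤) → (∫⁻ x, ‖iteratedFDeriv ℝ 1 v x‖ₑ ^ 2 < ⊤) → (∫⁻ x, ‖iteratedFDeriv ℝ 2 v x‖ₑ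 ^ 2 < ⊤) → |∫ x, ⟪Literature.Analysis.FluidPDE.curl v x, fderiv ℝ v x (Literature.Analysis.FluidPDE.curl v x)⟫_ℝ| ≤ (sInf {κ : ℝ | (∀ (v : EuclideanSpace ℝ (Fin 3) → EuclideanSpace ℝ (Fin 3)) (M B : ℝ), ContDiff ℝ (⊤ : ℕ∞) v → Literature.Analysis.FluidPDE.VectorCalculus.IsDivFree v → (∀ x, ‖v x‖ ≤ M) → (∀ x, ‖fderiv ℝ v x‖ ≤ B) → (∫⁻ x, ‖iteratedFDeriv ℝ 0 v x‖ₑ ^ 2 < ⊤) → (∫⁻ x, ‖iteratedFDeriv ℝ 1 v x‖ₑ ^ 2 < ⊤) → (∫⁻ x, ‖iteratedFDeriv ℝ 2 v x‖ₑ ^ 2 < ⊤) → |∫ x, ⟪Literature.Analysis.FluidPDE.curl v x, fderiv ℝ v x (Literature.Analysis.FluidPDE.curl v x)⟫_ℝ| ≤ κ * M * Real.sqrt (∫ x, ‖Literature.Analysis.FluidPDE.curl v x‖ ^ 2) * Real.sqrt (∫ x, Literature.Analysis.FluidPDE.frobeniusNormSq (fderiv ℝ (Literature.Analysis.FluidPDE.curl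 v) x)))}) * M * Real.sqrt (∫ x, ‖Literature.Analysis.FluidPDE.curl v x‖ ^ 2) * Real.sqrt (∫ x, Literature.Analysis.FluidPDE.frobeniusNormSq (fderiv ℝ (Literature.Analysis.FluidPDE.curl v) x))) := by
  intro v M B hv hdiv hM hB h0 h1 h2
  have hne : ({κ : ℝ | (∀ (v : EuclideanSpace ℝ (Fin 3) → EuclideanSpace ℝ (Fin 3)) (M B : ℝ), ContDiff ℝ (⊤ : ℕ∞) v → Literature.Analysis.FluidPDE.VectorCalculus.IsDivFree v → (∀ x, ‖v x‖ ≤ M) → (∀ x, ‖fderiv ℝ v x‖ ≤ B) → (∫⁻ x, ‖iteratedFDeriv ℝ 0 v x‖ₑ ^ 2 < ⊤) → (∫⁻ x, ‖iteratedFDeriv ℝ 1 v x‖ₑ ^ 2 < ⊤) → (∫⁻ x, ‖iteratedFDeriv ℝ 2 v x‖ₑ ^ 2 < ⊤) → |∫ x, ⟪Literature.Analysis.FluidPDE.curl v x, fderiv ℝ v x (Literature.Analysis.FluidPDE.curl v x)⟫_ℝ| ≤ κ * M * Real.sqrt (∫ x, ‖Literature.Analysis.FluidPDE.curl v x‖ ^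 2) * Real.sqrt (∫ x, Literature.Analysis.FluidPDE.frobeniusNormSq (fderiv ℝ (Literature.Analysis.FluidPDE.curl v) x)))}).Nonempty :=
    ⟨(9 + 2 * Real.sqrt 15) / 42, StrainCube.lambSplit_constant_is_universal⟩
  set J : ℝ := ∫ x, ⟪curl v x, fderiv ℝ v x (curl v x)⟫_ℝ with hJ
  set D : ℝ := M * Real.sqrt (∫ x, ‖curl v x‖ ^ 2) *
    Real.sqrt (∫ x, frobeniusNormSq (fderiv ℝ (curl v) x)) with hD
  have hM0 : 0 ≤ M := (norm_nonneg _).trans (hM 0)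
  have hD0 : 0 ≤ D := by rw [hD]; positivity
  have key : ∀ κ ∈ ({κ : ℝ | (∀ (v : EuclideanSpace ℝ (Fin 3) → EuclideanSpace ℝ (Fin 3)) (M B : ℝ), ContDiff ℝ (⊤ : ℕ∞) v → Literature.Analysis.FluidPDE.VectorCalculus.IsDivFree v → (∀ x, ‖v x‖ ≤ M) → (∀ x, ‖fderiv ℝ v x‖ ≤ B) → (∫⁻ x, ‖iteratedFDeriv ℝ 0 v x‖ₑ ^ 2 < ⊤) → (∫⁻ x, ‖iteratedFDeriv ℝ 1 v x‖ₑ ^ 2 < ⊤) → (∫⁻ x, ‖iteratedFDeriv ℝ 2 v x‖ₑ ^ 2 < ⊤) → |∫ x, ⟪Literature.Analysis.FluidPDE.curl v x, fderiv ℝ v x (Literature.Analysis.FluidPDE.curl v x)⟫_ℝ| ≤ κ * M * Real.sqrt (∫ x, ‖Literature.Analysis.FluidPDE.curl v x‖ ^ 2) * Real.sqrt (∫ x, Literature.Analysis.FluidPDE.frobeniusNormSq (fderiv ℝ (Literature.Analysis.FluidPDE.curl v) x)))}), |J| ≤ κ * D := by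
    intro κ hκ
    have h := hκ v M B hv hdiv hM hB h0 h1 h2
    simpa only [hJ, hD, mul_assoc] using h
  have goal : |J| ≤ sInf {κ : ℝ | (∀ (v : EuclideanSpace ℝ (Fin 3) → EuclideanSpace ℝ (Fin 3)) (M B : ℝ), ContDiff ℝ (⊤ : ℕ∞) v → Literature.Analysis.FluidPDE.VectorCalculus.IsDivFree v → (∀ x, ‖v x‖ ≤ M) → (∀ x, ‖fderiv ℝ v x‖ ≤ B) → (∫⁻ x, ‖iteratedFDeriv ℝ 0 v x‖ₑ ^ 2 < ⊤) → (∫⁻ x, ‖iteratedFDeriv ℝ 1 v x‖ₑ ^ 2 < ⊤) → (∫⁻ x, ‖iteratedFDeriv ℝ 2 v x‖ₑ ^ 2 < ⊤) → |∫ x, ⟪Literature.Analysis.FluidPDE.curl v x, fderiv ℝ v x (Literature.Analysis.FluidPDE.curl v x)⟫_ℝ| ≤ κ * M * Real.sqrt (∫ x, ‖Literature.Analysis.FluidPDE.curl v x‖ ^ 2) * Real.sqrt (∫ x, Literature.Analysis.FluidPDE.frobeniusNormSq (fderiv ℝ (Literature.Analysis.FluidPDE.curl v) x)))} * D := by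
    rcases hD0.eq_or_lt with hD00 | hDpos
    · obtain ⟨κ₁, hκ₁⟩ := hne
      have h := key κ₁ hκ₁
      rw [← hD00, mul_zero] at h ⊢
      exact h
    · have hlb : |J| / D ≤ sInf {κ : ℝ | (∀ (v : EuclideanSpace ℝ (Fin 3) → EuclideanSpace ℝ (Fin 3)) (M B : ℝ), ContDiff ℝ (⊤ : ℕ∞) v → Literature.Analysis.FluidPDE.VectorCalculus.IsDivFree v → (∀ x, ‖v x‖ ≤ M) → (∀ x, ‖fderiv ℝ v x‖ ≤ B) → (∫⁻ x, ‖iteratedFDeriv ℝ 0 v x‖ₑ ^ 2 < ⊤) → (∫⁻ x, ‖iteratedFDeriv ℝ 1 v x‖ₑ ^ 2 < ⊤) → (∫⁻ x, ‖iteratedFDeriv ℝ 2 v x‖ₑ ^ 2 < ⊤) → |∫ x, ⟪Literature.Analysis.FluidPDE.curl v x, fderiv ℝ v x (Literature.Analysis.FluidPDE.curl v x)⟫_ℝ| ≤ κ * M * Real.sqrt (∫ x, ‖Literature.Analysis.FluidPDE.curl v x‖ ^ 2) * Real.sqrt (∫ x, Literature.Analysis.FluidPDE.frobeniusNormSq (fderiv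 ℝ (Literature.Analysis.FluidPDE.curl v) x)))} :=
        le_csInf hne fun κ hκ => (div_le_iff₀ hDpos).2 (key κ hκ)
      exact (div_le_iff₀ hDpos).1 hlb
  simpa only [hJ, hD, mul_assoc] using goal

/-- **Lower bracket for `κ⋆`: `13/200 < κ⋆`** (`κ⋆` is universal; `StrainCube.universal_depletion_constant_gt_S5`).
[folklore] -/
theorem sharpDepletion_gt : (13 : ℝ) / 200 < sInf {κ : ℝ | (∀ (v : EuclideanSpace ℝ (Fin 3) → EuclideanSpace ℝ (Fin 3)) (M B : ℝ), ContDiff ℝ (⊤ : ℕ∞) v → Literature.Analysis.FluidPDE.VectorCalculus.IsDivFree v → (∀ x, ‖v x‖ ≤ M) → (∀ x, ‖fderiv ℝ v x‖ ≤ B) → (∫⁻ x, ‖iteratedFDeriv ℝ 0 v x‖ₑ ^ 2 < ⊤) → (∫⁻ x, ‖iteratedFDeriv ℝ 1 v x‖ₑ ^ 2 < ⊤) → (∫⁻ x, ‖iteratedFDeriv ℝ 2 v x‖ₑ ^ 2 < ⊤) → |∫ x, ⟪Literature.Analysis.FluidPDE.curl v x, fderiv ℝ v x (Literature.Analysis.FluidPDE.curl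 v x)⟫_ℝ| ≤ κ * M * Real.sqrt (∫ x, ‖Literature.Analysis.FluidPDE.curl v x‖ ^ 2) * Real.sqrt (∫ x, Literature.Analysis.FluidPDE.frobeniusNormSq (fderiv ℝ (Literature.Analysis.FluidPDE.curl v) x)))} :=
  StrainCube.universal_depletion_constant_gt_S5 sharpDepletion_is_universal

/-- **Upper bracket for `κ⋆`: `κ⋆ ≤ (9+2√15)/42 ≈ 0.3987`** (`StrainCube.lambSplit_constant_is_universal`). [folklore] -/
theorem sharpDepletion_le_lambSplit : sInf {κ : ℝ | (∀ (v : EuclideanSpace ℝ (Fin 3) → EuclideanSpace ℝ (Fin 3)) (M B : ℝ), ContDiff ℝ (⊤ : ℕ∞) v → Literature.Analysis.FluidPDE.VectorCalculus.IsDivFree v → (∀ x, ‖v x‖ ≤ M) → (∀ x, ‖fderiv ℝ v x‖ ≤ B) → (∫⁻ x, ‖iteratedFDeriv ℝ 0 v x‖ₑ ^ 2 < ⊤) → (∫⁻ x, ‖iteratedFDeriv ℝ 1 v x‖ₑ ^ 2 < ⊤) → (∫⁻ x, ‖iteratedFDeriv ℝ 2 v x‖ₑ ^ 2 < ⊤)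 → |∫ x, ⟪Literature.Analysis.FluidPDE.curl v x, fderiv ℝ v x (Literature.Analysis.FluidPDE.curl v x)⟫_ℝ| ≤ κ * M * Real.sqrt (∫ x, ‖Literature.Analysis.FluidPDE.curl v x‖ ^ 2) * Real.sqrt (∫ x, Literature.Analysis.FluidPDE.frobeniusNormSq (fderiv ℝ (Literature.Analysis.FluidPDE.curl v) x)))} ≤ (9 + 2 * Real.sqrt 15) / 42 :=
  sharpDepletion_le StrainCube.lambSplit_constant_is_universal

/-- `κ⋆ < 1` (from the upper bracket, `√15 < 4`). [folklore] -/
theorem sharpDepletion_lt_one : sInf {κ : ℝ | (∀ (v : EuclideanSpace ℝ (Fin 3) → EuclideanSpace ℝ (Fin 3)) (M B : ℝ), ContDiff ℝ (⊤ : ℕ∞) v → Literature.Analysis.FluidPDE.VectorCalculus.IsDivFree v → (∀ x, ‖v x‖ ≤ M) → (∀ x, ‖fderiv ℝ v x‖ ≤ B) → (∫⁻ x, ‖iteratedFDeriv ℝ 0 v x‖ₑ ^ 2 < ⊤) → (∫⁻ x, ‖iteratedFDeriv ℝ 1 v x‖ₑ ^ 2 < ⊤) → (∫⁻ x, ‖iteratedFDeriv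 ℝ 2 v x‖ₑ ^ 2 < ⊤) → |∫ x, ⟪Literature.Analysis.FluidPDE.curl v x, fderiv ℝ v x (Literature.Analysis.FluidPDE.curl v x)⟫_ℝ| ≤ κ * M * Real.sqrt (∫ x, ‖Literature.Analysis.FluidPDE.curl v x‖ ^ 2) * Real.sqrt (∫ x, Literature.Analysis.FluidPDE.frobeniusNormSq (fderiv ℝ (Literature.Analysis.FluidPDE.curl v) x)))} < 1 := by
  refine lt_of_le_of_lt sharpDepletion_le_lambSplit ?_
  have h15 : Real.sqrt 15 < 4 := by
    rw [Real.sqrt_lt' (by norm_num)]; norm_num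
  linarith

/-- **Onset removal (calculus).** If `k : ℝ → [0,1]` is measurable, `0 ≤ t₁ < T`, `0 ≤ a`, and
`∫_{t₁}^t k²/(T−τ) ≤ a·log((T−t₁)/(T−t)) + B` for all `t ∈ [t₁,T)`, then for some `B'` (namely
`∫_0^{t₁} k²/(T−τ) + max B 0`), `∫_0^t k²/(T−τ) ≤ a·log(T/(T−t)) + B'` for all `t ∈ [0,T)` (split the integral at
`t₁`; before `t₁` the integral is below `∫_0^{t₁}`; `log((T−t₁)/(T−t)) ≤ log(T/(T−t))`). [folklore] -/
theorem logMean_bound_from_zero {k : ℝ → ℝ} {T t₁ a B : ℝ} (hkm : Measurable k)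
    (hk01 : ∀ τ, 0 ≤ k τ ∧ k τ ≤ 1) (ht₁ : t₁ ∈ Ico 0 T) (ha : 0 ≤ a)
    (h : ∀ t ∈ Ico t₁ T, ∫ τ in t₁..t, k τ ^ 2 / (T - τ) ≤ a * Real.log ((T - t₁) / (T - t)) + B) :
    ∃ B' : ℝ, ∀ t ∈ Ico 0 T, ∫ τ in (0 : ℝ)..t, k τ ^ 2 / (T - τ) ≤ a * Real.log (T / (T - t)) + B' := by
  set I₁ : ℝ := ∫ τ in (0 : ℝ)..t₁, k τ ^ 2 / (T - τ) with hI₁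
  refine ⟨I₁ + max B 0, fun t ht => ?_⟩
  have hTt : 0 < T - t := sub_pos.2 ht.2
  have hlog0 : 0 ≤ Real.log (T / (T - t)) :=
    Real.log_nonneg ((one_le_div hTt).2 (by linarith [ht.1]))
  have hB0 : B ≤ max B 0 := le_max_left _ _
  have hmax0 : 0 ≤ max B 0 := le_max_right _ _
  rcases le_or_gt t₁ t with h1 | h1
  · -- `t₁ ≤ t < T`: split at `t₁` and compare the logarithms
    have hadd : ∫ τ in (0 : ℝ)..t, k τ ^ 2 / (T - τ) = I₁ + ∫ τ in t₁..t, k τ ^ 2 / (T - τ) :=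
      (intervalIntegral.integral_add_adjacent_intervals
        (intervalIntegrable_coeff_sq_div hkm hk01 ht₁.1 ht₁.2)
        (intervalIntegrable_coeff_sq_div hkm hk01 h1 ht.2)).symm
    have hb := h t ⟨h1, ht.2⟩
    have hlogle : Real.log ((T - t₁) / (T - t)) ≤ Real.log (T / (T - t)) :=
      Real.log_le_log (div_pos (sub_pos.2 ht₁.2) hTt)
        (div_le_div_of_nonneg_right (by linarith [ht₁.1]) hTt.le)
    have hmul := mul_le_mul_of_nonneg_left hlogle ha
    rw [hadd]
    linarith
  · -- `0 ≤ t < t₁`: the integral is below `I₁`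
    have hadd : I₁ = (∫ τ in (0 : ℝ)..t, k τ ^ 2 / (T - τ)) + ∫ τ in t..t₁, k τ ^ 2 / (T - τ) :=
      (intervalIntegral.integral_add_adjacent_intervals
        (intervalIntegrable_coeff_sq_div hkm hk01 ht.1 ht.2)
        (intervalIntegrable_coeff_sq_div hkm hk01 h1.le ht₁.2)).symm
    have hnn : 0 ≤ ∫ τ in t..t₁, k τ ^ 2 / (T - τ) :=
      intervalIntegral.integral_nonneg h1.le fun τ hτ =>
        div_nonneg (sq_nonneg _) (by linarith [hτ.2, ht₁.2])
    have hmul : 0 ≤ a * Real.log (T / (T - t)) := mul_nonneg ha hlog0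
    linarith

end DepletionLadder

end Summit.NavierStokesRegularity.NavierStokesRegularity.Theorems

end
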